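import Literature.IUT.HodgeTheaters.GaloisValDatumCoveringMonoidOrd
import Literature.IUT.HodgeTheaters.BadLocalFrobenioidDash
import Literature.IUT.HodgeArakelov.GMonoidFrobenioids
import HarnessLib

/-!
# B16 closer, divisor half: (A)'s divisor monoid of the GENUINE `C⊢_v` covering monoid `𝒪^×_{K̄_v}·q̲^ℕ` IS abc-iut-L1-t4's
# `Φ_{C⊢_v} = ℕ·log_Φ(q̲_v)` (the divisor monoid of `GaloisValDatum.dashDatum`) — a natural isomorphism over `B(K_v)⁰`

Mochizuki, *Inter-universal Teichmüller Theory I*, kurims manuscript (May 2020), Ex. 3.2 (iv) p. 71: «the image of `q̲_v`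
determines a constant section [i.e., a sub-monoid on `D_v` isomorphic to `ℕ`] `log_Φ(q̲_v)` of `Φ_{C_v}`», «`Φ_{C⊢_v} :=
ℕ·log_Φ(q̲_v)|_{D⊢_v}`» [cite: Mochizuki2012, I Ex 3.2 (iv) p.71] (the description of the monoid of `C⊢_v` as
`𝒪^×·q̲_v^ℕ` used below is OUR transported reading of (v) p. 72's `Θ`-side description along `C⊢_v ⥲ C^Θ_v`, not a
quotation); *… II*,
Def. 3.8 (ii) p. 113 «whose divisor monoid associates to every object … a monoid isomorphic to `ℕ`» [cite: Mochizuki2012,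
II Def 3.8 (ii) p.113] (D-0012 claim key, status disputed; nothing of the series is asserted); [FrdII] Ex. 1.1 (ii) p. 8
(«a monoprime subfunctor in monoids `Φ ⊆ Φ₀|_D`») [cite: MochizukiFrdII2008, Ex 1.1 (ii) p.8]; [FrdI] §0 p. 11 (`M^char`),
Prop. 5.3 p. 103 [cite: MochizukiFrdI2008, Prop. 5.3 p.103].

Cell abc-iut, seat abc-iut-L5-t2 (gen 7); row «B16-i» (δ2-η) (abc-iut-L6-t7 MERGE-MAP §B16).  DEF-BEARING (2 `MonoidHom`
defs, 1 `Units` def, 1 `MulEquiv`, 1 natural isomorphism; 0 instances / notation / `Prop` facts; nothing landed is edited).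
Consumed BY NAME: abc-iut-w4-d019's `CoveringMonoid.invariants / pull / invariantsFunctor / divisorFunctor / coe_pull_eq_act`
(p455796), abc-iut-L1's `charFunctor` / `associatesMap` ([FrdI] §0), abc-iut-L1-t4's monogenic [FrdII] datum API
`PadicFrd.Monogenic.gen / Φc / coe_ΦMap / phi0Map_gen / gen_pow_injective` (`PadicFrobenioidMonogenic.lean`) at
abc-iut-L5-t2's `GaloisValDatum.relEmb / dashDatum / fieldFunctor` (`BadLocalFrobenioidDash.lean`, p439574), abc-iut-L5-t2's
`dashCoveringMonoid / dashAct / dashOrd / dashOrdHom / dashOrd_spec / dashOrd_dashAct / dashOrd_toΩ` (p456702 / p457913),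
Mathlib's `Submonoid.powLogEquiv`.

WHAT THIS FILE CONSTRUCTS / PROVES (`d : GaloisValDatum p`, `q ∈ 𝒪^▷_{K_v}` NOT a unit, `M := d.dashCoveringMonoid q`):
* `invDashOrdHom V : M^V →* ℕ` (the divisor `u·q̲^n ↦ n` on the `V`-invariants) kills units (`invDashOrdHom_units`), hence
  descends to **`etaNat V : Associates (M^V) →* ℕ`** — (A)'s divisor monoid `Φ(G/V) = M^V/(M^V)^×` read in `ℕ`;
  **`etaNat_bijective`** (injective: equal divisors ⇒ associated in `M^V`, the quotient unit `u⁻¹u′` being `V`-invariant by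
  cancellation — `invariantUnitOfIsUnit`; surjective: `q̲ ∈ M^V` has divisor `1`);
* **`divisorObjEquiv V : Associates (M^V) ≃* ℕ·log_Φ(q̲)(G/V)`** — composed with Mathlib's `powLogEquiv` onto abc-iut-L1-t4's
  `Φ_{C⊢_v}(G/V) = powers (ord(q̲) ⊗ 1)` (`gen_pow_injective`): the class of `u·q̲^n` goes to `log_Φ(q̲)^n`
  (`coe_divisorObjEquiv_mk`);
* NATURALITY `divisorObjEquiv_pull`: (A)'s pull-back `associatesMap (pull f)` (action of a representative — divisor
  UNCHANGED, `dashOrd_dashAct`) matches L1-t4's restriction map of `Φ^c` (restriction of `Φ₀|_D`, fixing the constant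
  section, `phi0Map_gen`);
* **`divisorFunctorIso : (d.dashCoveringMonoid q).divisorFunctor ≅ (d.dashDatum hq).Φ`** — the natural isomorphism of
  functors `(CosetCat G_v)ᵒᵖ ⥤ CommMonCat`: the divisor monoid of abc-iut-w4-d019's [IUTchII] Def. 3.8 model Frobenioid of
  the genuine `C⊢_v` monoid IS the divisor monoid of the GENUINE `C⊢_v` of [IUTchI] Ex. 3.2 (iv).
NOT DONE HERE: the `B`-half (`(M^V)^gp ≅ B^c(G/V) = (Ω^V)^× ×_{Φ₀^gp} ℤ·log_Φ(q̲)`) and the resulting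
`ModelFrobenioid.DataHomOver (𝟭 _)` equivalence of the two Frobenioids (named follow-up (δ2-β)).  HONEST FRAMING: pure
monoid/valuation bookkeeping over the tree's interfaces; nothing asserts a Kummer structure or takes a side on [IUTchIII]
Cor. 3.12; [IUTchI]/[IUTchII] disputed, nothing asserted; typed ≠ proved for anything else.
-/

noncomputable section

open scoped Classical

namespace Literature.IUT.HodgeTheaters

open CategoryTheory Opposite Function Literature.AnabelianGeometry.SemiGraphs Literature.AlgebraicGeometry.Frobenioids
  Literature.AlgebraicGeometry.Frobenioids.PadicFrd Literature.IUT.HodgeArakelov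

universe u

namespace GaloisValDatum

variable {p : ℕ} [Fact p.Prime] (d : GaloisValDatum.{u} p) {q : intNonzero d.k}

/-! ### The carrier of `dashCoveringMonoid` (definitionally `↥(dashCovering q)`): explicit conversions -/

/-- An element of the carrier `(d.dashCoveringMonoid q).O` read in `↥(d.dashCovering q)` (the two types are definitionally
equal, p456702; the conversion keeps statements type-correct for rewriting). [cite: Mochizuki2012, I Ex 3.2 (v) p.72] -/
abbrev ofO (x : (d.dashCoveringMonoid q).O) : d.dashCovering q := x

/-- `ofO` is multiplicative (definitionally). [cite: Mochizuki2012, I Ex 3.2 (v) p.72] -/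
theorem ofO_mul (x y : (d.dashCoveringMonoid q).O) : d.ofO (x * y) = d.ofO x * d.ofO y := rfl

/-- `ofO 1 = 1`. [cite: Mochizuki2012, I Ex 3.2 (v) p.72] -/
theorem ofO_one : d.ofO (1 : (d.dashCoveringMonoid q).O) = 1 := rfl

/-- The action of `dashCoveringMonoid` is `dashAct` (definitionally). [cite: Mochizuki2012, II Def 4.9 (i) p.154] -/
theorem ofO_act (σ : d.Gal) (x : (d.dashCoveringMonoid q).O) :
    d.ofO ((d.dashCoveringMonoid q).act σ x) = d.dashAct q σ (d.ofO x) := rfl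

/-! ### The divisor on `V`-invariants and its descent to (A)'s divisor monoid `M^V/(M^V)^×` -/

/-- **The divisor `u·q̲^n ↦ n` on the `V`-invariants `M^V` of `M = 𝒪^×_{K̄_v}·q̲^ℕ`** (restriction of `dashOrdHom`).
[cite: Mochizuki2012, I Ex 3.2 (iv) p.71] -/
def invDashOrdHom (hq : ¬ IsUnit q) (V : Subgroup d.Gal) :
    ↥((d.dashCoveringMonoid q).invariants V) →* Multiplicative ℕ where
  toFun x := Multiplicative.ofAdd (d.dashOrd hq (d.ofO x.1))
  map_one' := by
    change Multiplicative.ofAdd (d.dashOrd hq (d.ofO 1)) = 1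
    rw [ofO_one, d.dashOrd_one hq]
    rfl
  map_mul' x y := by
    change Multiplicative.ofAdd (d.dashOrd hq (d.ofO (x.1 * y.1))) = _
    rw [ofO_mul, d.dashOrd_mul hq, ofAdd_add]

/-- Values of `invDashOrdHom`. [cite: Mochizuki2012, I Ex 3.2 (iv) p.71] -/
theorem invDashOrdHom_apply (hq : ¬ IsUnit q) (V : Subgroup d.Gal) (x : (d.dashCoveringMonoid q).invariants V) :
    d.invDashOrdHom hq V x = Multiplicative.ofAdd (d.dashOrd hq (d.ofO x.1)) := rfl

/-- Units of `M^V` have divisor `0` (they are units of `𝒪^▷_{K̄_v}`). [cite: MochizukiFrdI2008, §0 p.11] -/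
theorem invDashOrdHom_units (hq : ¬ IsUnit q) (V : Subgroup d.Gal) (u : (↥((d.dashCoveringMonoid q).invariants V))ˣ) :
    d.invDashOrdHom hq V (u : (d.dashCoveringMonoid q).invariants V) = 1 := by
  have hu : IsUnit ((d.ofO (u : (d.dashCoveringMonoid q).invariants V).1 : intNonzero d.Ω)) :=
    (u.isUnit.map ((d.dashCoveringMonoid q).invariants V).subtype).map (d.dashCovering q).subtype
  rw [invDashOrdHom_apply, (d.dashOrd_eq_zero_iff hq (d.ofO (u : (d.dashCoveringMonoid q).invariants V).1)).mpr hu]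
  rfl

/-- **(A)'s divisor monoid read in `ℕ`**: `Φ(G/V) = M^V/(M^V)^× →* ℕ`, `[u·q̲^n] ↦ n` (the divisor descends through the
class map since units have divisor `0`). [cite: MochizukiFrdI2008, §0 p.11] -/
def etaNat (hq : ¬ IsUnit q) (V : Subgroup d.Gal) :
    Associates ↥((d.dashCoveringMonoid q).invariants V) →* Multiplicative ℕ where
  toFun := Quotient.lift (d.invDashOrdHom hq V) (by
    rintro a b ⟨u, rfl⟩
    rw [map_mul, d.invDashOrdHom_units hq V u, mul_one])
  map_one' := map_one (d.invDashOrdHom hq V)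
  map_mul' x y := Quotient.inductionOn₂ x y fun a b => map_mul (d.invDashOrdHom hq V) a b

/-- `etaNat [x] = dashOrd x`. [cite: Mochizuki2012, I Ex 3.2 (iv) p.71] -/
theorem etaNat_mk (hq : ¬ IsUnit q) (V : Subgroup d.Gal) (x : (d.dashCoveringMonoid q).invariants V) :
    d.etaNat hq V (Associates.mk x) = Multiplicative.ofAdd (d.dashOrd hq (d.ofO x.1)) := rfl

/-- `q̲`, as a `V`-invariant element of `M` (it lies over `Spec K_v`). [cite: Mochizuki2012, I Ex 3.2 (iv) p.71] -/
def toΩInvariant (q : intNonzero d.k) (V : Subgroup d.Gal) : ↥((d.dashCoveringMonoid q).invariants V) :=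
  ⟨⟨d.toΩ q, d.toΩ_mem_dashCovering q⟩,
    (CoveringMonoid.mem_invariants_iff _).mpr fun σ _ => Subtype.ext (d.galAct_toΩ σ q)⟩

/-- `q̲` has divisor `1`. [cite: Mochizuki2012, I Ex 3.2 (iv) p.71] -/
theorem invDashOrdHom_toΩInvariant (hq : ¬ IsUnit q) (V : Subgroup d.Gal) :
    d.invDashOrdHom hq V (d.toΩInvariant q V) = Multiplicative.ofAdd 1 := by
  rw [invDashOrdHom_apply]
  exact congrArg Multiplicative.ofAdd (d.dashOrd_toΩ hq)

/-- `etaNat` is SURJECTIVE (`[q̲^n] ↦ n`). [cite: Mochizuki2012, I Ex 3.2 (iv) p.71] -/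
theorem etaNat_surjective (hq : ¬ IsUnit q) (V : Subgroup d.Gal) : Surjective (d.etaNat hq V) := fun n => by
  refine ⟨Associates.mk (d.toΩInvariant q V ^ Multiplicative.toAdd n), ?_⟩
  change d.invDashOrdHom hq V (d.toΩInvariant q V ^ Multiplicative.toAdd n) = n
  rw [map_pow, invDashOrdHom_toΩInvariant, ← ofAdd_nsmul, smul_eq_mul, mul_one, ofAdd_toAdd]

/-- A `V`-INVARIANT UNIT `w` of `𝒪^▷_{K̄_v}` as a unit of `M^V` (its inverse is `V`-invariant too).
[cite: MochizukiFrdI2008, §0 p.11] -/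
def invariantUnitOfIsUnit (V : Subgroup d.Gal) (w : intNonzero d.Ω) (hw : IsUnit w)
    (hV : ∀ σ ∈ V, d.galAct σ w = w) : (↥((d.dashCoveringMonoid q).invariants V))ˣ where
  val := ⟨⟨w, d.mem_dashCovering_of_isUnit q hw⟩,
    (CoveringMonoid.mem_invariants_iff _).mpr fun σ hσ => Subtype.ext (hV σ hσ)⟩
  inv := ⟨⟨((hw.unit⁻¹ : (intNonzero d.Ω)ˣ) : intNonzero d.Ω), d.mem_dashCovering_of_isUnit q (hw.unit⁻¹).isUnit⟩,
    (CoveringMonoid.mem_invariants_iff _).mpr fun σ hσ => Subtype.ext (by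
      have hmap : Units.map (d.galAct σ).toMonoidHom hw.unit = hw.unit := Units.ext (hV σ hσ)
      have h : (((Units.map (d.galAct σ).toMonoidHom hw.unit)⁻¹ : (intNonzero d.Ω)ˣ) : intNonzero d.Ω) =
          ((hw.unit⁻¹ : (intNonzero d.Ω)ˣ) : intNonzero d.Ω) :=
        congrArg (fun t : (intNonzero d.Ω)ˣ => ((t⁻¹ : (intNonzero d.Ω)ˣ) : intNonzero d.Ω)) hmap
      rw [Units.coe_map_inv] at h
      change d.galAct σ ((hw.unit⁻¹ : (intNonzero d.Ω)ˣ) : intNonzero d.Ω) = ((hw.unit⁻¹ : (intNonzero d.Ω)ˣ) : intNonzero d.Ω)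
      exact h)⟩
  val_inv := Subtype.ext (Subtype.ext hw.mul_val_inv)
  inv_val := Subtype.ext (Subtype.ext hw.val_inv_mul)

/-- `V`-invariance of an element of `M^V`, read on `𝒪^▷_{K̄_v}`. [cite: Mochizuki2012, II Def 4.9 (i) p.154] -/
theorem galAct_coe_eq_of_invariants {V : Subgroup d.Gal} (x : (d.dashCoveringMonoid q).invariants V) {σ : d.Gal}
    (hσ : σ ∈ V) : d.galAct σ ((d.ofO x.1 : d.dashCovering q) : intNonzero d.Ω) = (d.ofO x.1 : d.dashCovering q) := by
  have h : d.ofO ((d.dashCoveringMonoid q).act σ x.1) = d.ofO x.1 :=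
    congrArg d.ofO ((CoveringMonoid.mem_invariants_iff _).mp x.2 σ hσ)
  rw [ofO_act] at h
  exact congrArg (fun z : d.dashCovering q => (z : intNonzero d.Ω)) h

/-- `etaNat` is INJECTIVE: `V`-invariant elements with the same divisor are associated in `M^V` (the quotient `u⁻¹·u′` of
their unit parts is a `V`-invariant unit, by cancellation in `𝒪^▷_{K̄_v}`). [cite: MochizukiFrdI2008, §0 p.11] -/
theorem etaNat_injective (hq : ¬ IsUnit q) (V : Subgroup d.Gal) : Injective (d.etaNat hq V) := by
  intro a b
  obtain ⟨x, rfl⟩ := Associates.mk_surjective a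
  obtain ⟨y, rfl⟩ := Associates.mk_surjective b
  intro h
  rw [etaNat_mk, etaNat_mk] at h
  have hn : d.dashOrd hq (d.ofO x.1) = d.dashOrd hq (d.ofO y.1) := Multiplicative.ofAdd.injective h
  obtain ⟨u, hu, hx⟩ := d.dashOrd_spec hq (d.ofO x.1)
  obtain ⟨u', hu', hy⟩ := d.dashOrd_spec hq (d.ofO y.1)
  -- the candidate unit `w := u⁻¹ · u′`
  set w : intNonzero d.Ω := ((hu.unit⁻¹ : (intNonzero d.Ω)ˣ) : intNonzero d.Ω) * u' with hwdef
  have hw : IsUnit w := (hu.unit⁻¹).isUnit.mul hu'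
  have hyw : ((d.ofO y.1 : d.dashCovering q) : intNonzero d.Ω) = ((d.ofO x.1 : d.dashCovering q) : intNonzero d.Ω) * w := by
    rw [hy, hx, hn, hwdef]
    calc u' * d.toΩ q ^ d.dashOrd hq (d.ofO y.1)
        = (u * ((hu.unit⁻¹ : (intNonzero d.Ω)ˣ) : intNonzero d.Ω)) * (u' * d.toΩ q ^ d.dashOrd hq (d.ofO y.1)) := by
          rw [hu.mul_val_inv, one_mul]
      _ = u * d.toΩ q ^ d.dashOrd hq (d.ofO y.1) * (((hu.unit⁻¹ : (intNonzero d.Ω)ˣ) : intNonzero d.Ω) * u') := by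
          ac_rfl
  -- `w` is `V`-invariant: `σ w · x = σ y = y = w · x` and `𝒪^▷_{K̄_v}` is cancellative
  have hV : ∀ σ ∈ V, d.galAct σ w = w := by
    intro σ hσ
    have hxσ := d.galAct_coe_eq_of_invariants x hσ
    have hyσ := d.galAct_coe_eq_of_invariants y hσ
    have key : d.galAct σ w * ((d.ofO x.1 : d.dashCovering q) : intNonzero d.Ω) =
        w * ((d.ofO x.1 : d.dashCovering q) : intNonzero d.Ω) := by
      have h1 := hyσ
      rw [hyw, map_mul, hxσ, mul_comm] at h1
      rw [h1, mul_comm]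
    exact d.intNonzero_mul_right_cancel key
  refine Associates.mk_eq_mk_iff_associated.mpr ⟨d.invariantUnitOfIsUnit V w hw hV, ?_⟩
  apply Subtype.ext
  apply Subtype.ext
  exact hyw.symm

/-- **`etaNat` is bijective: (A)'s divisor monoid `M^V/(M^V)^×` IS `ℕ`.** [cite: Mochizuki2012, II Def 3.8 (ii) p.113] -/
theorem etaNat_bijective (hq : ¬ IsUnit q) (V : Subgroup d.Gal) : Bijective (d.etaNat hq V) :=
  ⟨d.etaNat_injective hq V, d.etaNat_surjective hq V⟩

/-! ### Onto abc-iut-L1-t4's `Φ_{C⊢_v}(G/V) = ℕ·log_Φ(q̲_v)` -/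

/-- L1-t4's generator `log_Φ(q̲)(G/V) = ord(q̲) ⊗ 1 ∈ Φ₀(G/V)` has distinct powers (the fixed fields are `p`-adic local fields).
[cite: MochizukiFrdII2008, Ex 1.1 (ii) p.8] -/
theorem gen_pow_injective (hq : ¬ IsUnit q) (X : CosetCat d.Gal) :
    Injective fun n : ℕ => Monogenic.gen d.fieldFunctor (d.relEmb.img q) X ^ n :=
  Monogenic.gen_pow_injective d.fieldFunctor (d.relEmb.isConstantSection hq) (d.fieldFunctor_isPadicLocal X)

/-- **`Φ(G/V) = M^V/(M^V)^× ≃* Φ_{C⊢_v}(G/V) = ℕ·log_Φ(q̲_v)(G/V)`**: (A)'s divisor monoid of the genuine `C⊢_v` covering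
monoid IS abc-iut-L1-t4's divisor monoid of the genuine `C⊢_v` at every object — the class of `u·q̲^n` goes to `log_Φ(q̲)^n`.
[cite: Mochizuki2012, I Ex 3.2 (iv) p.71] -/
def divisorObjEquiv (hq : ¬ IsUnit q) (X : CosetCat d.Gal) :
    Associates ↥((d.dashCoveringMonoid q).invariants (X.sg : Subgroup d.Gal)) ≃*
      ↥(Submonoid.powers (Monogenic.gen d.fieldFunctor (d.relEmb.img q) X)) :=
  (MulEquiv.ofBijective (d.etaNat hq X.sg) (d.etaNat_bijective hq X.sg)).trans
    (Submonoid.powLogEquiv (d.gen_pow_injective hq X))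

/-- Values: the class of `x = u·q̲^n` goes to `log_Φ(q̲)^n`. [cite: Mochizuki2012, I Ex 3.2 (iv) p.71] -/
theorem coe_divisorObjEquiv_mk (hq : ¬ IsUnit q) (X : CosetCat d.Gal)
    (x : (d.dashCoveringMonoid q).invariants (X.sg : Subgroup d.Gal)) :
    ((d.divisorObjEquiv hq X (Associates.mk x) : Submonoid.powers (Monogenic.gen d.fieldFunctor (d.relEmb.img q) X)) :
        Realification (OrdInt (d.fieldFunctor.obj X).K)) =
      Monogenic.gen d.fieldFunctor (d.relEmb.img q) X ^ d.dashOrd hq (d.ofO x.1) := by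
  change ((Submonoid.powLogEquiv (d.gen_pow_injective hq X) (d.etaNat hq X.sg (Associates.mk x)) :
    Submonoid.powers _) : Realification (OrdInt (d.fieldFunctor.obj X).K)) = _
  rw [etaNat_mk, Submonoid.powLogEquiv_apply, toAdd_ofAdd]
  rfl

/-! ### Naturality -/

/-- (A)'s pull-back of divisors along `f : G/U → G/V` does not change the exponent: `pull f` is the action of a
representative `g`, and `dashOrd (g·x) = dashOrd x`. [cite: Mochizuki2012, II Def 3.8 (i) p.113] -/
theorem dashOrd_pull (hq : ¬ IsUnit q) {X Y : CosetCat d.Gal} (f : X ⟶ Y)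
    (y : (d.dashCoveringMonoid q).invariants (Y.sg : Subgroup d.Gal)) :
    d.dashOrd hq (d.ofO ((d.dashCoveringMonoid q).pull f y).1) = d.dashOrd hq (d.ofO y.1) := by
  obtain ⟨g, hg⟩ := Quotient.exists_rep (CosetCat.pt f)
  have h : d.ofO ((d.dashCoveringMonoid q).pull f y).1 = d.ofO ((d.dashCoveringMonoid q).act g y.1) :=
    congrArg d.ofO ((d.dashCoveringMonoid q).coe_pull_eq_act f hg y)
  rw [h, ofO_act]
  exact d.dashOrd_dashAct hq g (d.ofO y.1)

/-- **NATURALITY** of `divisorObjEquiv`: it intertwines (A)'s `associatesMap (pull f)` with abc-iut-L1-t4's restriction map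
`Φ^c(f)` of `Φ_{C⊢_v}` (both send `log_Φ(q̲)^n` to `log_Φ(q̲)^n`: the divisor is unchanged under the Galois action, and the
restriction maps of `Φ₀|_D` fix the constant section `log_Φ(q̲)`). [cite: MochizukiFrdII2008, Ex 1.1 (ii) p.8] -/
theorem divisorObjEquiv_pull (hq : ¬ IsUnit q) {X Y : CosetCat d.Gal} (f : X ⟶ Y)
    (a : Associates ↥((d.dashCoveringMonoid q).invariants (Y.sg : Subgroup d.Gal))) :
    d.divisorObjEquiv hq X (associatesMap ((d.dashCoveringMonoid q).pull f) a) =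
      ((d.dashDatum hq).Φ.map f.op).hom (d.divisorObjEquiv hq Y a) := by
  obtain ⟨y, rfl⟩ := Associates.mk_surjective a
  apply Subtype.ext
  rw [associatesMap_mk, coe_divisorObjEquiv_mk, dashOrd_pull]
  change _ = phi0Map d.fieldFunctor f.op ((d.divisorObjEquiv hq Y (Associates.mk y) : Submonoid.powers _) :
    Realification (OrdInt (d.fieldFunctor.obj Y).K))
  rw [coe_divisorObjEquiv_mk, map_pow, Monogenic.phi0Map_gen d.fieldFunctor (d.relEmb.isConstantSection hq)]

/-- **`(d.dashCoveringMonoid q).divisorFunctor ≅ (d.dashDatum hq).Φ`** — the natural isomorphism of functors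
`(CosetCat G_v)ᵒᵖ ⥤ CommMonCat`: the divisor monoid of abc-iut-w4-d019's [IUTchII] Def. 3.8 model Frobenioid of the GENUINE
`C⊢_v` covering monoid IS the divisor monoid `Φ_{C⊢_v} = ℕ·log_Φ(q̲_v)|_{D⊢_v}` of the GENUINE `C⊢_v` of [IUTchI] Ex. 3.2 (iv)
(abc-iut-L1-t4's monogenic datum over the field functor). [cite: Mochizuki2012, I Ex 3.2 (iv) p.71] -/
def divisorFunctorIso (hq : ¬ IsUnit q) : (d.dashCoveringMonoid q).divisorFunctor ≅ (d.dashDatum hq).Φ :=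
  NatIso.ofComponents (fun X => (d.divisorObjEquiv hq (unop X)).toCommMonCatIso) fun {X Y} f => by
    apply CommMonCat.hom_ext
    refine MonoidHom.ext fun a => ?_
    exact d.divisorObjEquiv_pull hq f.unop a

end GaloisValDatum

/-! ### At the genuine datum -/

namespace InitialThetaData

open NumberField IsDedekindDomain

variable {F K Fbar : Type} [Field F] [NumberField F] [Field K] [NumberField K] [Algebra F K]
  [Field Fbar] [Algebra F Fbar] [Algebra K Fbar] [IsScalarTower F K Fbar] {E : WeierstrassCurve F}
  [E.IsElliptic] {l : ℕ} {Pb : BadPlacePredicates K} (D : InitialThetaData F K Fbar E l Pb)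
  {v : FinitePlace F} (hv : v ∈ D.VFbad) (w : HeightOneSpectrum (𝓞 K)) [w.asIdeal.LiesOver v.maximalIdeal.asIdeal]
  (p : ℕ) [Fact p.Prime] (hw : ((p : ℕ) : 𝓞 K) ∈ w.asIdeal)

/-- **At the genuine datum**: (A)'s divisor monoid of `𝒪^×_{K̄_w}·q̲_v̲^ℕ ↶ Gal(K̄_w/K_w)` IS the divisor monoid of the GENUINE
`C⊢_v̲ = D.badCdashAt hv w p hw` of [IUTchI] Ex. 3.2 (iv), naturally over `B(K_v̲)⁰`. [claim: Mochizuki2012, status: disputed] -/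
def badDivisorFunctorIso :
    ((GaloisValDatum.ofPlace K p w hw).dashCoveringMonoid (D.qRootAt hv w p hw)).divisorFunctor ≅
      ((GaloisValDatum.ofPlace K p w hw).dashDatum (D.qRootAt_not_isUnit hv w p hw)).Φ :=
  (GaloisValDatum.ofPlace K p w hw).divisorFunctorIso (D.qRootAt_not_isUnit hv w p hw)

end InitialThetaData

end Literature.IUT.HodgeTheaters

end
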